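import Literature.NumberTheory.LFunctions.WeilTwoPrimeDeflL2Base
import Literature.NumberTheory.LFunctions.WeilBlockRowsPZ
import HarnessLib

/-!
# Deflated two-prime certificate L2: the factored even inverse agrees with `D`, rows 48–55

`WeilCert.checkDnRow` (even block) for certificate L2, by `decide +kernel`. Pure proof file.
-/

noncomputable section

namespace Literature.NumberTheory.LFunctions

set_option maxHeartbeats 0 in
/-- Row 48 of `DnE/LsE` is row 48 of the even `D` (certificate L2). [folklore] -/
theorem checkDnRow0_48_weilCertDeflL2 : weilCertDeflL2Base.checkDnRow weilCertDeflL2DnE weilCertDeflL2LsE 0 48 = true := by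
  decide +kernel

set_option maxHeartbeats 0 in
/-- Row 49 of `DnE/LsE` is row 49 of the even `D` (certificate L2). [folklore] -/
theorem checkDnRow0_49_weilCertDeflL2 : weilCertDeflL2Base.checkDnRow weilCertDeflL2DnE weilCertDeflL2LsE 0 49 = true := by
  decide +kernel

set_option maxHeartbeats 0 in
/-- Row 50 of `DnE/LsE` is row 50 of the even `D` (certificate L2). [folklore] -/
theorem checkDnRow0_50_weilCertDeflL2 : weilCertDeflL2Base.checkDnRow weilCertDeflL2DnE weilCertDeflL2LsE 0 50 = true := by
  decide +kernel

set_option maxHeartbeats 0 in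
/-- Row 51 of `DnE/LsE` is row 51 of the even `D` (certificate L2). [folklore] -/
theorem checkDnRow0_51_weilCertDeflL2 : weilCertDeflL2Base.checkDnRow weilCertDeflL2DnE weilCertDeflL2LsE 0 51 = true := by
  decide +kernel

set_option maxHeartbeats 0 in
/-- Row 52 of `DnE/LsE` is row 52 of the even `D` (certificate L2). [folklore] -/
theorem checkDnRow0_52_weilCertDeflL2 : weilCertDeflL2Base.checkDnRow weilCertDeflL2DnE weilCertDeflL2LsE 0 52 = true := by
  decide +kernel

set_option maxHeartbeats 0 in
/-- Row 53 of `DnE/LsE` is row 53 of the even `D` (certificate L2). [folklore] -/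
theorem checkDnRow0_53_weilCertDeflL2 : weilCertDeflL2Base.checkDnRow weilCertDeflL2DnE weilCertDeflL2LsE 0 53 = true := by
  decide +kernel

set_option maxHeartbeats 0 in
/-- Row 54 of `DnE/LsE` is row 54 of the even `D` (certificate L2). [folklore] -/
theorem checkDnRow0_54_weilCertDeflL2 : weilCertDeflL2Base.checkDnRow weilCertDeflL2DnE weilCertDeflL2LsE 0 54 = true := by
  decide +kernel

set_option maxHeartbeats 0 in
/-- Row 55 of `DnE/LsE` is row 55 of the even `D` (certificate L2). [folklore] -/
theorem checkDnRow0_55_weilCertDeflL2 : weilCertDeflL2Base.checkDnRow weilCertDeflL2DnE weilCertDeflL2LsE 0 55 = true := by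
  decide +kernel


end Literature.NumberTheory.LFunctions
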